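import Summits.QuantumFields.BalabanUV.T4Continuum.Spine.NE1p.DressedTransportAssembledData
import Summits.QuantumFields.BalabanUV.T4Continuum.Support.T4TrajectoryDensityWitnessK2

/-!
# T⁴ programme, spine estimate NE1′ (node O3b/H2) — NON-VACUITY OF END-F″ (`transportLeaf_assembled_canonical`, hence of END-F′
# `transportLeaf_assembled`, DAG node N22 — the crew's load-bearing assembled transport leaf), part 1 of 3: THE DATUM
# (formalisation crew `b2b-balaban-t4-ne1p-formalise-*`, leaf seat 03, row W2; own-initiative consistency item, NOT a crew
# estimate row)

Cell `pub-balaban`, sub-cell `t4`, BINDER-OWNERS row NE1′ (owner lineage t4-ne1p-p1).  ADDITIVE — imports the crew's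
`Spine/NE1p/DressedTransportAssembledData` (leaf-01, rows S2/S2b) and the lineage's K = 2 toy
`Support/T4TrajectoryDensityWitnessK2` ONLY; modifies nothing.  Parts: 1 = this file (the toy's first dressed functional on
large windows + the datum), 2 = `…WitnessBinders` (END-F″'s weight, window, radius and fresh-pair binders on the datum),
3 = `…Witness` (END-F″ BY NAME on the datum, then END-B's per-cutoff face `classAt_of_bookingLeaves`, and the gate's
non-triviality).  One namespace for the three parts.

WHY (the three parts).  Row W1 (`Spine/NE1p/DressedTransportWitness`, p212613) inhabits END-F's 21 binders jointly; END-F″∕END-F′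
(`DressedTransportAssembledData.transportLeaf_assembled_canonical` ∕ `DressedTransportAssembled.transportLeaf_assembled`, leaf-01)
have a DIFFERENT and larger binder family — 37 hypothesis binders: the Assembly's DICTIONARY `hQ` (the centred observable-attached
exponent IS `c·Σ` over the live generations `Sg k b` of the differences of CARRIED functionals at the fresh pair `(U+z, U+z₁)`),
live-generation bookkeeping `hSg`, the radius schedule `hϱ_birth`∕`hϱ_succ`∕`hϱfloor`∕`hmargin` against the canonical slice radius
`rsOf`, the source-factor link `hcm`, fresh defects `hδf`∕`hδfw`, cross-generation nesting `hN1x`∕`hN2cx` (complex margin on a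
tube), the fresh pairs `hpairx` in relative gauge for a.e. fluctuation, measurability `hmeas` — on top of END-F's.  The cross-read
X2 checks the composition binder by binder; JOINT SATISFIABILITY of the family (the F-g19 failure mode of this pipeline, gen 19)
is what a witness certifies, and none existed for N22.  These three files discharge ALL 37 binders SIMULTANEOUSLY on ONE datum in
which the observable exponent carries a LIVE GENERATION AT BOTH MET STEPS — at step 1 the genuinely DRESSED functional
`Fn 0 1 = 10U₀₀ + λ(U)∕5` sits inside the exponent — and both atoms of the fluctuation measure form genuine fresh pairs.

THIS PART.  §1: the toy's closed forms were proved in `T4TrajectoryDensityWitness` for `‖U₀₀‖ ≤ 1`; the exponent slice at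
step 1 moves the bond variable along complex charts of radius `6`, so §1 re-proves them on LARGE discs: `1 + ω ≠ 0` and
`‖λ‖ ≤ 3/5` for `‖U₀₀‖ ≤ 20`, the closed form `Fn_one_of_le`, the size `‖Fn 0 1 U‖ ≤ 10‖U₀₀‖ + 3/25`, the logistic weight `lamC`
as a holomorphic function of the bond variable on `‖u‖ < 20` (`differentiableOn_lamC`), and REALITY of `Fn 0 1` at real bond
variables (`Fn_one_im_of_real`).  §2: the datum — trajectory `TrA` (`gen = 190·[k′=0]`, `lin = [k′=0]`), windows
`WinA k = bondBall (13 − 6k)`, chart radii `ϱ_k = 1 + 2·2^{−k}` (floor `r_* = 1`, birth radius `r = 4`), margin radii `ϱ₁`,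
live generations `SgA k b = {(b,0)}` (`k ≤ 1`), live families `SA`, margins `sA ≡ ½`, source factors `mA = 2⁻²⁴`,
`cA = 2⁻²⁶`, fresh defect `δfA = 1/100`, reference fluctuation `z₁A ≡ 1/100 = z_H/2`, and THE OBSERVABLE-ATTACHED EXPONENT BY
THE ASSEMBLY'S DICTIONARY `𝒬A k b U z := qA U + cA·Σ_{p ∈ SgA k b} (Fn p.2 k (U+z) − Fn p.2 k (U+z₁A))` with action part
`𝒜A := 𝒜₁ − 𝒬A` (so the carried functionals are the toy's `Fn`, `hFn` verbatim); elementary facts about the radii.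

HONEST FRAMING.  Rung (B)+1 bookkeeping on ONE finite four-torus of fixed physical size — NOT infinite volume, NOT a mass
gap, NOT OS on ℝ⁴, NOT the Clay problem, NOT summit progress.  NE1′ is NOT PRINTED and NOT PROVED; every headline reads
«NE1′ ⇐ the named binders» / «L-T ⇐ F-1…F-9»; spine PROVED 0∕9 unchanged.  A TOY: nothing of Bałaban's densities or of
[Balaban1989LargeFieldII] (1.71)–(1.75) pp. 379–380 is encoded (CONTEXT only, carried by the imported headers); no
`def … : Prop`; every declaration is [folklore] toy kernel mathematics, 0 sorry, 0 citations.  HONEST DEPENDENCY: continuum YM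
on T⁴ ⇐ BetaPertH ∧ nine spine estimates (0/9 proved); BetaPertH ⇐ (D1) ∧ (D4) ∧ CAP+tail; G-an2-4 gates asym, D1 and NE2/3/4.
-/

noncomputable section

namespace Summit.QuantumFields.BalabanUV.T4Continuum.NE1p.DressedTransportAssembledWitness

open MeasureTheory Set Metric Filter Finset
open scoped BigOperators
open Literature.MathematicalPhysics.QuantumFieldTheory.Balaban1983to89
open Literature.MathematicalPhysics.QuantumFieldTheory.Balaban1983to89.T4TermFormat
open Literature.MathematicalPhysics.QuantumFieldTheory.Balaban1983to89.T4TermFormat.Booking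
open Literature.MathematicalPhysics.QuantumFieldTheory.Balaban1983to89.T4GatedBooking
open Literature.MathematicalPhysics.QuantumFieldTheory.Balaban1983to89.T4TrajectoryComparison
open T4TrajectoryModulus (bondBall bondBall_add_mem bondBall_latMove_add_mem bondBall_diam)
open T4BlockTransport (Fld NDir latMove latN Site norm_dir_le)
open T4BirthChartTransport (GaugeInvariant BirthSlice RelGauge)
open T4TrajectoryDensity
open Summit.QuantumFields.BalabanUV.T4Continuum.T4TrajectoryDensityDressed
open Summit.QuantumFields.BalabanUV.T4Continuum.T4TrajectoryDensityWitness
open Summit.QuantumFields.BalabanUV.T4Continuum.NE1p.DressedRoot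
open Summit.QuantumFields.BalabanUV.T4Continuum.NE1p.DressedTransportAssembledData

/-! ## §1 The toy's first dressed functional on LARGE windows: closed form, bound, reality, slice-holomorphy [folklore] -/

/-- `‖ω_U(z_H) − 1‖ ≤ 2‖U₀₀‖/500` for `‖U₀₀‖ ≤ 500` (the complex bound `‖e^x − 1‖ ≤ 2‖x‖`, `‖x‖ ≤ 1`). [folklore] -/
theorem norm_expWeight_atomH_sub_one_le {U : Fld 4 ℂ} (hU : ‖ev₀₀ U‖ ≤ 500) :
    ‖expWeight base₁ 𝒜₁ U atomH - 1‖ ≤ 2 * (‖ev₀₀ U‖ / 500) := by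
  rw [expWeight_atomH]
  have hx : ‖-(𝒜₁ U atomH)‖ = ‖ev₀₀ U‖ / 500 := by rw [norm_neg, norm_𝒜₁_atomH]
  have h1 : ‖-(𝒜₁ U atomH)‖ ≤ 1 := by rw [hx, div_le_one (by norm_num)]; exact hU
  calc ‖Complex.exp (-(𝒜₁ U atomH)) - 1‖ ≤ 2 * ‖-(𝒜₁ U atomH)‖ := Complex.norm_exp_sub_one_le h1
    _ = 2 * (‖ev₀₀ U‖ / 500) := by rw [hx]

/-- The normalisation `1 + ω_U(z_H)` does not vanish for `‖U₀₀‖ ≤ 20`. [folklore] -/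
theorem one_add_expWeight_ne_zero_of_le {U : Fld 4 ℂ} (hU : ‖ev₀₀ U‖ ≤ 20) :
    1 + expWeight base₁ 𝒜₁ U atomH ≠ 0 := by
  intro h
  have h2 := norm_expWeight_atomH_sub_one_le (hU.trans (by norm_num))
  rw [show expWeight base₁ 𝒜₁ U atomH - 1 = -2 by linear_combination h] at h2
  norm_num at h2
  linarith

/-- `‖λ(U)‖ ≤ 3/5` for `‖U₀₀‖ ≤ 20`. [folklore] -/
theorem norm_lam₁_le_of_le {U : Fld 4 ℂ} (hU : ‖ev₀₀ U‖ ≤ 20) : ‖lam₁ U‖ ≤ 3 / 5 := by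
  have h1 : ‖expWeight base₁ 𝒜₁ U atomH - 1‖ ≤ 2 / 25 := by
    have := norm_expWeight_atomH_sub_one_le (hU.trans (by norm_num)); linarith
  unfold lam₁
  set q := expWeight base₁ 𝒜₁ U atomH
  have hn : ‖q‖ ≤ 27 / 25 :=
    calc ‖q‖ = ‖(q - 1) + 1‖ := by rw [sub_add_cancel]
      _ ≤ ‖q - 1‖ + ‖(1 : ℂ)‖ := norm_add_le _ _
      _ ≤ 27 / 25 := by rw [norm_one]; linarith
  have hd : 48 / 25 ≤ ‖1 + q‖ := by
    have h := norm_sub_norm_le (2 : ℂ) (-(q - 1))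
    rw [show (2 : ℂ) - -(q - 1) = 1 + q by ring, norm_neg] at h
    have h2 : ‖(2 : ℂ)‖ = 2 := by simp
    linarith
  rw [norm_div, div_le_iff₀ (by linarith)]
  linarith

/-- First dressed step in closed form on large windows: `Fn 0 1 U = 10U₀₀ + λ(U)/5` for `‖U₀₀‖ ≤ 20`. [folklore] -/
theorem Fn_one_of_le {U : Fld 4 ℂ} (hU : ‖ev₀₀ U‖ ≤ 20) : Fn 0 1 U = 10 * ev₀₀ U + lam₁ U * (1 / 5) := by
  rw [Fn_succ le_rfl, wOp_two (one_add_expWeight_ne_zero_of_le hU)]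
  simp only [Fn_zero_zero, ev₀₀_add, ev₀₀_atomH, add_zero]
  push_cast; ring

/-- The crude size of the first dressed functional: `‖Fn 0 1 U‖ ≤ 10‖U₀₀‖ + 3/25` for `‖U₀₀‖ ≤ 20`. [folklore] -/
theorem norm_Fn_one_le {U : Fld 4 ℂ} (hU : ‖ev₀₀ U‖ ≤ 20) : ‖Fn 0 1 U‖ ≤ 10 * ‖ev₀₀ U‖ + 3 / 25 := by
  rw [Fn_one_of_le hU]
  have h := norm_lam₁_le_of_le hU
  calc ‖10 * ev₀₀ U + lam₁ U * (1 / 5)‖ ≤ ‖10 * ev₀₀ U‖ + ‖lam₁ U * (1 / 5)‖ := norm_add_le _ _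
    _ = 10 * ‖ev₀₀ U‖ + ‖lam₁ U‖ * (1 / 5) := by
        rw [norm_mul, norm_mul]; simp
    _ ≤ 10 * ‖ev₀₀ U‖ + 3 / 25 := by linarith

/-- The logistic weight as a function of the bond variable `U₀₀ = u`: `λ = e^{−u/500}/(1 + e^{−u/500})`. [folklore] -/
def lamC (u : ℂ) : ℂ :=
  Complex.exp (-(((1 / 10 : ℝ) : ℂ) * u * ((1 / 50 : ℝ) : ℂ))) /
    (1 + Complex.exp (-(((1 / 10 : ℝ) : ℂ) * u * ((1 / 50 : ℝ) : ℂ))))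

/-- `λ(U) = lamC U₀₀`. [folklore] -/
theorem lam₁_eq_lamC (U : Fld 4 ℂ) : lam₁ U = lamC (ev₀₀ U) := by
  rw [lam₁, expWeight_atomH, 𝒜₁, ev₀₀_atomH, lamC]

/-- The denominator of `lamC u` does not vanish for `‖u‖ ≤ 20`. [folklore] -/
theorem lamC_den_ne_zero {u : ℂ} (hu : ‖u‖ ≤ 20) :
    1 + Complex.exp (-(((1 / 10 : ℝ) : ℂ) * u * ((1 / 50 : ℝ) : ℂ))) ≠ 0 := by
  have h := one_add_expWeight_ne_zero_of_le (U := fun _ _ => u) (by simpa [ev₀₀] using hu)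
  rwa [expWeight_atomH, 𝒜₁, ev₀₀_atomH, show ev₀₀ (fun _ _ => u) = u from rfl] at h

/-- `lamC` is holomorphic on the disc `‖u‖ < 20`. [folklore] -/
theorem differentiableOn_lamC : DifferentiableOn ℂ lamC (ball (0 : ℂ) 20) := by
  unfold lamC
  refine DifferentiableOn.div (by fun_prop) (by fun_prop) fun u hu => ?_
  exact lamC_den_ne_zero (by rw [mem_ball, dist_zero_right] at hu; exact hu.le)

/-- At a real bond variable the logistic weight is real. [folklore] -/
theorem lamC_ofReal (x : ℝ) :
    lamC (x : ℂ) = ((Real.exp (-(1 / 10 * x * (1 / 50))) / (1 + Real.exp (-(1 / 10 * x * (1 / 50)))) : ℝ) : ℂ) := by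
  unfold lamC
  push_cast
  rfl

/-- The first dressed functional is REAL at real bond variables (`‖x‖ ≤ 20`). [folklore] -/
theorem Fn_one_im_of_real {U : Fld 4 ℂ} {x : ℝ} (hU : ev₀₀ U = x) (hx : |x| ≤ 20) : (Fn 0 1 U).im = 0 := by
  have hn : ‖ev₀₀ U‖ ≤ 20 := by rw [hU, Complex.norm_real, Real.norm_eq_abs]; exact hx
  rw [Fn_one_of_le hn, lam₁_eq_lamC, hU, lamC_ofReal]
  generalize Real.exp (-(1 / 10 * x * (1 / 50))) / (1 + Real.exp (-(1 / 10 * x * (1 / 50)))) = y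
  have e : (10 : ℂ) * (x : ℂ) + (y : ℂ) * (1 / 5) = ((10 * x + y * (1 / 5) : ℝ) : ℂ) := by push_cast; ring
  rw [e, Complex.ofReal_im]


/-! ## §2 The datum: trajectory, windows, radii, live generations, the observable exponent BY THE ASSEMBLY'S DICTIONARY [folklore] -/

/-- Generation sizes: `190·[k′ = 0]` (the birth sup of `10·U₀₀` over the radius-13 window along charts of radius 4). [folklore] -/
def genA (k' : ℕ) : ℝ := if k' = 0 then 190 else 0

/-- The booked trajectory over `Bk = oneBirth 2`: `lin = [k′ = 0]` (the toy's currency `linT`), `gen = genA`. [folklore] -/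
def TrA : Trajectory Bk where
  lin := fun _ k' _ => linT k'
  lin_nonneg := fun _ k' _ => by unfold linT; split_ifs <;> norm_num
  gen := fun _ k' => genA k'
  gen_nonneg := fun _ k' => by unfold genA; split_ifs <;> norm_num
  size_le := Tr.size_le

/-- Window radii `13 − 6k` (gaps `6 ≥ w + ϱ₁ + ½`: room for the complex margin (N2ᶜ)). [folklore] -/
def radA (k : ℕ) : ℝ := 13 - 6 * k

/-- The windows: bond balls of radii `13 ⊋ 7 ⊋ 1`. [folklore] -/
def WinA (k : ℕ) : Set (Fld 4 ℂ) := bondBall 4 (radA k)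

/-- Chart radii of the dressed steps: `ϱ_k = 1 + 2·2^{−k}` — strictly decreasing, below the birth radius `r = 4`, above the
floor `r_* = 1`. [folklore] -/
def ϱA (k : ℕ) : ℝ := 1 + 2 * (1 / 2 : ℝ) ^ k

/-- Margin radii `ϱ₁ k` = the current slice radius of the live generation (`rsOf 4 ϱ _ 0 k`): `4` at `k = 0`, `ϱ_{k−1} =
1 + 4·2^{−k}` afterwards. [folklore] -/
def ϱ₁A (k : ℕ) : ℝ := if k = 0 then 4 else 1 + 4 * (1 / 2 : ℝ) ^ k

/-- Live GENERATIONS of the met component at step `k`: the birth generation `(b, 0)` while the trajectory runs (`k ≤ 1`). [folklore] -/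
def SgA (k : ℕ) (b : Bk.Birth) : Finset (Bk.Birth × ℕ) := if k ≤ 1 then {(b, 0)} else ∅

/-- Live FAMILIES of the met component at step `k`: the family itself for `k ≤ 2`, none beyond. [folklore] -/
def SA (k : ℕ) (b : Bk.Birth) : Finset Bk.Birth := if k ≤ 2 then {b} else ∅

/-- Action oscillation margins `½`. [folklore] -/
def sA : Bk.Birth → ℕ → ℝ := fun _ _ => 1 / 2

/-- Source factor of the dressed budget: `2⁻²⁴` ((w6) `hsmall` an equality, §5). [folklore] -/
def mA : ℝ := 1 / 16777216

/-- The source factor of the observable exponent: `c = m·r_*/r = 2⁻²⁶` (`hcm` an equality). [folklore] -/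
def cA : ℂ := ((1 / 67108864 : ℝ) : ℂ)

/-- The fresh transverse defect of every fresh pair: `1/100` (= the sup norm of `z − z₁` at both atoms). [folklore] -/
def δfA : ℝ := 1 / 100

/-- The reference fluctuation `z₁ ≡ 1/100 = z_H/2` — distinct from BOTH atoms, so both atoms form genuine fresh pairs. [folklore] -/
def z₁A : Fld 4 ℂ := fun _ _ => ((1 / 100 : ℝ) : ℂ)

/-- [folklore] -/ @[simp] theorem ev₀₀_z₁A : ev₀₀ z₁A = ((1 / 100 : ℝ) : ℂ) := rfl

/-- The free fluctuation-constant part `q U = U₀₀/100` of the observable-attached exponent. [folklore] -/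
def qA (U : Fld 4 ℂ) : ℂ := ((1 / 100 : ℝ) : ℂ) * ev₀₀ U

/-- **THE OBSERVABLE-ATTACHED EXPONENT BY THE ASSEMBLY'S DICTIONARY** (`hQ` as a definition): `𝒬 k b U z := q U + c·Σ_{p ∈ Sg k b}
(Fn p.2 k (U + z) − Fn p.2 k (U + z₁))` — the centred exponent IS the fresh sum of the CARRIED functionals of the live
generations (the birth functional at `k = 0`, the DRESSED functional `Fn 0 1` at `k = 1`). [folklore] -/
def 𝒬A (k : ℕ) (b : Bk.Birth) (U z : Fld 4 ℂ) : ℂ :=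
  qA U + cA * ∑ p ∈ SgA k b, (Fn p.2 k (U + z) - Fn p.2 k (U + z₁A))

/-- The ACTION part: the rest of the toy exponent, so that `𝒜 + 𝒬 = 𝒜₁` and the carried functionals are the toy's `Fn`. [folklore] -/
def 𝒜A (k : ℕ) (b : Bk.Birth) (U z : Fld 4 ℂ) : ℂ := 𝒜₁ U z - 𝒬A k b U z

/-- The split recomposes the toy exponent. [folklore] -/
theorem 𝒜A_add_𝒬A (k : ℕ) (b : Bk.Birth) : 𝒜A k b + 𝒬A k b = 𝒜₁ := by
  funext U z
  simp [𝒜A]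

/-- At step `0` the live generation is the (linear) birth functional: `𝒬 0 b U z = q U + c·(10z₀₀ − 1/10)`. [folklore] -/
theorem 𝒬A_zero (b : Bk.Birth) (U z : Fld 4 ℂ) :
    𝒬A 0 b U z = qA U + cA * (10 * ev₀₀ z - ((1 / 10 : ℝ) : ℂ)) := by
  simp only [𝒬A, SgA, zero_le_one, ↓reduceIte, sum_singleton, Fn_zero_zero, ev₀₀_add, ev₀₀_z₁A]
  push_cast
  ring

/-- At step `1` the live generation is the DRESSED functional: `𝒬 1 b U z = q U + c·(Fn 0 1 (U+z) − Fn 0 1 (U+z₁))`. [folklore] -/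
theorem 𝒬A_one (b : Bk.Birth) (U z : Fld 4 ℂ) :
    𝒬A 1 b U z = qA U + cA * (Fn 0 1 (U + z) - Fn 0 1 (U + z₁A)) := by
  simp only [𝒬A, SgA, le_refl, ↓reduceIte, sum_singleton]

/-- [folklore] -/
theorem norm_cA : ‖cA‖ = 1 / 67108864 := by
  rw [cA, Complex.norm_real, Real.norm_eq_abs, abs_of_pos (by norm_num)]

/-- [folklore] -/
theorem ϱA_pos (k : ℕ) : 0 < ϱA k := by unfold ϱA; positivity

/-- [folklore] -/
theorem one_le_ϱA (k : ℕ) : 1 ≤ ϱA k := by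
  unfold ϱA
  have : (0 : ℝ) ≤ 2 * (1 / 2 : ℝ) ^ k := by positivity
  linarith

/-- [folklore] -/
theorem ϱA_le_three (k : ℕ) : ϱA k ≤ 3 := by
  unfold ϱA
  have : (1 / 2 : ℝ) ^ k ≤ 1 := pow_le_one₀ (by norm_num) (by norm_num)
  linarith

/-- [folklore] -/
theorem ϱA_succ_lt (k : ℕ) : ϱA (k + 1) < ϱA k := by
  unfold ϱA
  have : (0 : ℝ) < (1 / 2 : ℝ) ^ k := by positivity
  rw [pow_succ]
  linarith

/-- [folklore] -/
theorem ϱ₁A_pos (k : ℕ) : 0 < ϱ₁A k := by unfold ϱ₁A; split_ifs <;> positivity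

/-- [folklore] -/
theorem ϱ₁A_le_four (k : ℕ) : ϱ₁A k ≤ 4 := by
  unfold ϱ₁A
  split_ifs
  · exact le_rfl
  · have : (1 / 2 : ℝ) ^ k ≤ 1 / 2 := by
      obtain ⟨j, rfl⟩ : ∃ j, k = j + 1 := ⟨k - 1, by omega⟩
      rw [pow_succ]
      have : (1 / 2 : ℝ) ^ j ≤ 1 := pow_le_one₀ (by norm_num) (by norm_num)
      nlinarith
    linarith

/-- The chart radius is STRICTLY inside the margin radius: `ϱ_k < ϱ₁ k`. [folklore] -/
theorem ϱA_lt_ϱ₁A (k : ℕ) : ϱA k < ϱ₁A k := by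
  unfold ϱA ϱ₁A
  split_ifs with h
  · subst h; norm_num
  · have : (0 : ℝ) < (1 / 2 : ℝ) ^ k := by positivity
    linarith

/-- `0 ∈` every window the trajectory uses. [folklore] -/
theorem zero_mem_WinA {k : ℕ} (hk : k ≤ 2) : (0 : Fld 4 ℂ) ∈ WinA k := fun x ν => by
  have : (k : ℝ) ≤ 2 := by exact_mod_cast hk
  simp only [Pi.zero_apply, norm_zero, radA]; linarith

/-- `z₁` is a fluctuation of size `≤ ½`. [folklore] -/
theorem z₁A_mem : z₁A ∈ (bondBall 4 (1 / 2) : Set (Fld 4 ℂ)) := fun x ν => by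
  simp only [z₁A, Complex.norm_real]; norm_num

/-- `5e³ ≤ 128` (Mathlib's nine-digit bound on `e`), so `α ≡ 128 ≥ e³·(1 + 4θ/ϱ_k)` since `ϱ_k ≥ 1 = θ`. [arith] [folklore] -/
theorem five_mul_exp_three_le : 5 * Real.exp 3 ≤ 128 := by
  have h1 : Real.exp 1 < 2.7182818286 := Real.exp_one_lt_d9
  have h0 : 0 < Real.exp 1 := Real.exp_pos 1
  have h3 : Real.exp 3 = Real.exp 1 ^ 3 := by rw [← Real.exp_nat_mul]; norm_num
  rw [h3]
  nlinarith [pow_le_pow_left₀ h0.le h1.le 3]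

end Summit.QuantumFields.BalabanUV.T4Continuum.NE1p.DressedTransportAssembledWitness

end
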